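import Literature.NumberTheory.Sieve.PolymathLcmSumsColouring

/-!
# Maynard (2016), Lemma 6: the coupled Euler product behind the main term ((6.10)–(6.13))

Trunk: AntSieve / parity (Maynard 2016 large-gaps ladder, named fact
`Literature.NumberTheory.Sieve.Maynard2016.Lemma6MainTerm` of `Maynard2016Lemma6Split.lean`).

In the proof of Lemma 6 of J. Maynard, *Large gaps between primes*, Ann. of Math. 183 (2016) =
arXiv:1408.5110, §6, the Fourier-expanded main term is the multiple sum (6.10) over
`d_1,…,d_k, d'_1,…,d'_k, e_1,…,e_k, e'_1,…,e'_k` of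

  `∏_ℓ μ(d_ℓ)μ(d'_ℓ)μ(e_ℓ)μ(e'_ℓ) d_ℓ^{-s_ℓ} (d'_ℓ)^{-s'_ℓ} e_ℓ^{-r_ℓ} (e'_ℓ)^{-r'_ℓ} / [d, d', e, e']`

with the summation conditions of (6.8): the `D_i = [d_i, d'_i]` pairwise coprime, the
`E_j = [e_j, e'_j]` pairwise coprime, all coprime to `W = P_w`, `(E_j, m) = 1`, and a prime may divide
both `D_i` and `E_j` only if it divides `m q (h_j − h_i) − 1` ("`(d_j, e_ℓ) | m q(h_ℓ − h_j) − 1`").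
Maynard notes (p. 10) that "since the restrictions imposed on the summation are multiplicative and the
summand is also multiplicative, we can rewrite the sum as a product `∏_p K_p`", and computes `K_p`
in (6.11)–(6.13): compared with the uncoupled factor there is, at the primes `p ∤ m` with
`p | m q(h_ℓ − h_j) − 1`, "an additional factor … involving the product of `d_j` and `e_ℓ`".

This file proves that Euler product factorisation exactly and in closed form, in the generality of the
tree's Polymath 8b engine (`PolymathLcmSumsColouring.lean`): two index types `ι` (the `d`-slots) and
`κ` (the `e`-slots), weights `g_i, h_i, g'_j, h'_j : ℕ → ℂ` multiplicative over products of distinct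
primes (`LcmEuler.IsPrimeProdMult`), an integer `m` switching the `e`-slots off at the primes dividing
it, and a coupling datum `M : ℕ → Finset (ι × κ)` (`M p` = the pairs `(i, j)` allowed to share the
prime `p`; for Maynard `M p = {(i,j) : p ∣ m q (h_j − h_i) − 1}`).  For a finite set of primes `P`:

  `∑_{(d,d'), (e,e') supported on P, D_i pw. coprime, E_j pw. coprime, CrossCond}
       (∏_i g_i(d_i) h_i(d'_i)) (∏_j g'_j(e_j) h'_j(e'_j)) / lcm(∏_i D_i, ∏_j E_j)
     = ∏_{p ∈ P} ( 1 + (1/p) [ ∑_i A_i(p) + [p ∤ m] ( ∑_j B_j(p) + ∑_{(i,j) ∈ M p} A_i(p) B_j(p) ) ] )`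

(`LcmEuler.sum_coupled_eq_prod`), where `A_i(p) = g_i(p)h_i(p) + g_i(p) + h_i(p)` and
`B_j(p) = g'_j(p)h'_j(p) + g'_j(p) + h'_j(p)` (`LcmEuler.slotTerm`; with `g = h = μ · p^{-s}` these are
Maynard's `p^{-s-s'} − p^{-s} − p^{-s'}`).  The coupled pairs enter with weight `1/p` (not `1/p²`)
because a shared prime is counted once in the least common multiple — this is the source of the
factor `1 + #{j,ℓ : p | m q(h_ℓ − h_j) − 1}/p = 1 − (ω_{m,q}(p) − 2k)/p` of (6.13).

The proof: the bijection of the Colouring layer between admissible pairs supported on `P` and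
colourings `P → Option (ι × Fin 3)` (`colourOf`, `colourFst_colourOf`, `colour_injective`), applied to
the `d`-side and the `e`-side separately (`sum_filter_pairBox_eq_sum_colour`); the cross condition
becomes a prime-by-prime condition on the pair of colours (`crossCond_colour_iff`, `AllowedAt`); the
summand is the product over the primes of local weights (`coupledSummand_colour`, using
`gcd(∏ D_i, ∏ E_j) = ∏_{p coloured on both sides} p`, `gcd_prod_primes_eq`); and
`∑_{c ∈ ∏_p Allowed_p} ∏_p w_p(c_p) = ∏_p ∑_{Allowed_p} w_p` (`Finset.prod_univ_sum`), with the local sum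
evaluated in closed form (`sum_allowed_coupledWeight_eq`).  Everything here is elementary and proved.

## References

* J. Maynard, *Large gaps between primes*, Ann. of Math. (2) 183 (2016), 915–933; arXiv:1408.5110,
  §6, proof of Lemma 6, displays (6.8), (6.10)–(6.13). [Maynard2016LargeGaps]
* D. H. J. Polymath, *Variants of the Selberg sieve, and bounded intervals containing many primes*,
  Res. Math. Sci. 1 (2014), Art. 12; arXiv:1407.4897, proof of Lemma 4.1, (euler-fac). [Polymath8b2014]
-/

noncomputable section

open Finset
open scoped BigOperators Classical

namespace Literature.NumberTheory.Sieve

namespace LcmEuler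

variable {ι κ : Type*} [DecidableEq ι] [DecidableEq κ] [Fintype ι] [Fintype κ]

/-! ### The coupled summation condition, summand and local factor -/

/-- The cross conditions of Maynard's `Σ'` in (6.8)/(6.10) linking the `e`-side to `m` and to the
`d`-side, for pairs `tD = (d, d')`, `tE = (e, e')` supported on the primes of `P`:
`(E_j, m) = 1` for all `j`, and a prime `p ∈ P` dividing both `D_i = [d_i,d'_i]` and `E_j = [e_j,e'_j]`
must have `(i, j) ∈ M p` (for Maynard: `p ∣ m q (h_j − h_i) − 1`).
[cite: Maynard2016LargeGaps, §6 display (6.8)] -/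
def CrossCond (P : Finset ℕ) (m : ℕ) (M : ℕ → Finset (ι × κ)) (tD : (ι → ℕ) × (ι → ℕ))
    (tE : (κ → ℕ) × (κ → ℕ)) : Prop :=
  (∀ j, Nat.Coprime (Nat.lcm (tE.1 j) (tE.2 j)) m) ∧
    ∀ q ∈ P, ∀ i j, q ∣ Nat.lcm (tD.1 i) (tD.2 i) → q ∣ Nat.lcm (tE.1 j) (tE.2 j) → (i, j) ∈ M q

/-- The summand of (6.10) (numerators general):
`(∏_i g_i(d_i) h_i(d'_i)) (∏_j g'_j(e_j) h'_j(e'_j)) / lcm(∏_i [d_i,d'_i], ∏_j [e_j,e'_j])`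
(the denominator is `[d, d', e, e']` when the `[d_i,d'_i]` and the `[e_j,e'_j]` are pairwise coprime).
[cite: Maynard2016LargeGaps, §6 display (6.10)] -/
def coupledSummand (g h : ι → ℕ → ℂ) (g' h' : κ → ℕ → ℂ) (tD : (ι → ℕ) × (ι → ℕ))
    (tE : (κ → ℕ) × (κ → ℕ)) : ℂ :=
  ((∏ i, g i (tD.1 i) * h i (tD.2 i)) * ∏ j, g' j (tE.1 j) * h' j (tE.2 j)) /
    (Nat.lcm (∏ i, Nat.lcm (tD.1 i) (tD.2 i)) (∏ j, Nat.lcm (tE.1 j) (tE.2 j)) : ℂ)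

/-- The local term of one slot at the prime `q`: `A_i(q) = g_i(q) h_i(q) + g_i(q) + h_i(q)` (for
`g_i = h_i = μ · q^{-s}`: `q^{-s_i-s'_i} − q^{-s_i} − q^{-s'_i}`, cf. (6.11)).
[cite: Maynard2016LargeGaps, §6 display (6.11)] -/
def slotTerm {α : Type*} (g h : α → ℕ → ℂ) (q : ℕ) (i : α) : ℂ := g i q * h i q + g i q + h i q

/-- **The coupled Euler factor `K_p`** of (6.11)–(6.13) in closed form:
`K_p = 1 + (1/p) [ ∑_i A_i(p) + [p ∤ m] ( ∑_j B_j(p) + ∑_{(i,j) ∈ M p} A_i(p) B_j(p) ) ]`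
(the `e`-slots are switched off at `p ∣ m`; a coupled pair shares the single factor `1/p` of the lcm).
[cite: Maynard2016LargeGaps, §6 displays (6.11)–(6.13)] -/
def coupledLocalFactor (g h : ι → ℕ → ℂ) (g' h' : κ → ℕ → ℂ) (m : ℕ) (M : ℕ → Finset (ι × κ))
    (q : ℕ) : ℂ :=
  1 + ((∑ i, slotTerm g h q i) +
      (if q ∣ m then 0 else
        (∑ j, slotTerm g' h' q j) + ∑ p ∈ M q, slotTerm g h q p.1 * slotTerm g' h' q p.2)) / q

omit [DecidableEq ι] [DecidableEq κ] in
/-- `coupledSummand = pairSummand(d-side) · pairSummand(e-side) · gcd(∏ D_i, ∏ E_j)`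
(`lcm · gcd = product`). [folklore] -/
private theorem coupledSummand_eq_mul_gcd (g h : ι → ℕ → ℂ) (g' h' : κ → ℕ → ℂ)
    {tD : (ι → ℕ) × (ι → ℕ)} {tE : (κ → ℕ) × (κ → ℕ)}
    (hD : ∀ i, 0 < Nat.lcm (tD.1 i) (tD.2 i)) (hE : ∀ j, 0 < Nat.lcm (tE.1 j) (tE.2 j)) :
    coupledSummand g h g' h' tD tE = pairSummand g h tD * pairSummand g' h' tE *
      (Nat.gcd (∏ i, Nat.lcm (tD.1 i) (tD.2 i)) (∏ j, Nat.lcm (tE.1 j) (tE.2 j)) : ℂ) := by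
  set PD := ∏ i, Nat.lcm (tD.1 i) (tD.2 i) with hPD
  set PE := ∏ j, Nat.lcm (tE.1 j) (tE.2 j) with hPE
  have hPD0 : 0 < PD := Finset.prod_pos fun i _ => hD i
  have hPE0 : 0 < PE := Finset.prod_pos fun j _ => hE j
  have hL0 : (Nat.lcm PD PE : ℂ) ≠ 0 := by exact_mod_cast (Nat.lcm_pos hPD0 hPE0).ne'
  have hPDc : (PD : ℂ) ≠ 0 := by exact_mod_cast hPD0.ne'
  have hPEc : (PE : ℂ) ≠ 0 := by exact_mod_cast hPE0.ne'
  have key : (Nat.gcd PD PE : ℂ) * (Nat.lcm PD PE : ℂ) = PD * PE := by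
    exact_mod_cast Nat.gcd_mul_lcm PD PE
  have hinv : (1 : ℂ) / (Nat.lcm PD PE : ℂ) = (Nat.gcd PD PE : ℂ) / ((PD : ℂ) * PE) := by
    rw [eq_div_iff (mul_ne_zero hPDc hPEc), ← key]
    field_simp
  have h1 : pairSummand g h tD = (∏ i, g i (tD.1 i) * h i (tD.2 i)) / (PD : ℂ) := by
    rw [pairSummand, hPD, Nat.cast_prod, ← Finset.prod_div_distrib]
  have h2 : pairSummand g' h' tE = (∏ j, g' j (tE.1 j) * h' j (tE.2 j)) / (PE : ℂ) := by
    rw [pairSummand, hPE, Nat.cast_prod, ← Finset.prod_div_distrib]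
  rw [coupledSummand, ← hPD, ← hPE, h1, h2, div_eq_mul_one_div _ (Nat.lcm PD PE : ℂ), hinv]
  field_simp

/-! ### Colourings: the bijection, divisibility and the cross condition -/

section Colour

variable {P : Finset ℕ} (hP : ∀ q ∈ P, q.Prime)
include hP

omit [DecidableEq κ] [Fintype κ] in
/-- The bijection of the Colouring layer as a reindexing: a sum over the admissible pairs supported on
`P` is a sum over colourings. [cite: Polymath8b2014, Lemma 4.1 (proof, (euler-fac))] -/
theorem sum_filter_pairBox_eq_sum_colour (f : (ι → ℕ) × (ι → ℕ) → ℂ) :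
    ∑ t ∈ (pairBox ι P).filter PairwiseCoprimeLcm, f t =
      ∑ c : ↥P → Colour ι, f (colourFst P c, colourSnd P c) := by
  have hprod0 : (∏ q ∈ P, q) ≠ 0 := Finset.prod_ne_zero_iff.2 fun q hq => (hP q hq).ne_zero
  symm
  refine Finset.sum_bij (fun c _ => (colourFst P c, colourSnd P c)) ?_ ?_ ?_ (fun _ _ => rfl)
  · intro c _
    simp only [Finset.mem_filter, pairBox, Finset.mem_product, Fintype.mem_piFinset,
      Nat.mem_divisors]
    exact ⟨⟨fun j => ⟨colourFst_dvd_prod hP c j, hprod0⟩, fun j => ⟨colourSnd_dvd_prod hP c j, hprod0⟩⟩,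
      fun i j hij => coprime_lcm_of_ne hP c hij⟩
  · intro c₁ _ c₂ _ heq
    simp only [Prod.mk.injEq] at heq
    exact colour_injective hP heq.1 heq.2
  · intro t ht
    simp only [Finset.mem_filter, pairBox, Finset.mem_product, Fintype.mem_piFinset,
      Nat.mem_divisors] at ht
    obtain ⟨⟨h1, h2⟩, hpw⟩ := ht
    refine ⟨colourOf (P := P) t, Finset.mem_univ _, ?_⟩
    ext j
    · exact colourFst_colourOf hP hpw (fun j => (h1 j).1) j
    · exact colourSnd_colourOf hP hpw (fun j => (h2 j).1) j

omit [DecidableEq κ] [Fintype κ] [Fintype ι] in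
/-- A prime `q ∈ P` divides `[d_i, d'_i]` of a colouring iff its colour has index `i`. [folklore] -/
private theorem dvd_lcm_colour_iff (c : ↥P → Colour ι) (i : ι) (q : ↥P) :
    (q : ℕ) ∣ Nat.lcm (colourFst P c i) (colourSnd P c i) ↔ ∃ a, c q = some (i, a) := by
  rw [lcm_colourFst_colourSnd hP, (prime_coe hP q).dvd_mul, (prime_coe hP q).dvd_mul,
    dvd_colourPart_iff hP, dvd_colourPart_iff hP, dvd_colourPart_iff hP]
  constructor
  · rintro ((h | h) | h) <;> exact ⟨_, h⟩
  · rintro ⟨a, h⟩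
    fin_cases a
    · exact Or.inl (Or.inl h)
    · exact Or.inl (Or.inr h)
    · exact Or.inr h

omit [DecidableEq κ] [Fintype κ] in
/-- `∏_i [d_i, d'_i]` of a colouring is the product of the coloured primes. [folklore] -/
private theorem prod_lcm_colour_eq (c : ↥P → Colour ι) :
    ∏ i, Nat.lcm (colourFst P c i) (colourSnd P c i) =
      ∏ q ∈ Finset.univ.filter (fun q : ↥P => c q ≠ none), (q : ℕ) := by
  set S := Finset.univ.filter (fun q : ↥P => c q ≠ none) with hS
  have hfib : ∏ q ∈ S, (q : ℕ) =
      ∏ o : Colour ι, ∏ q ∈ S.filter (fun q => c q = o), (q : ℕ) :=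
    (Finset.prod_fiberwise_of_maps_to (g := c) (t := Finset.univ) (fun q _ => Finset.mem_univ _) _).symm
  rw [hfib, Fintype.prod_option]
  have hnone : S.filter (fun q => c q = none) = ∅ := by
    rw [Finset.filter_eq_empty_iff]
    intro q hq
    exact (Finset.mem_filter.1 hq).2
  rw [hnone, Finset.prod_empty, one_mul, Fintype.prod_prod_type]
  refine Finset.prod_congr rfl fun i _ => ?_
  rw [lcm_colourFst_colourSnd hP, Fin.prod_univ_three]
  have hfil : ∀ a : Fin 3, S.filter (fun q => c q = some (i, a)) =
      Finset.univ.filter (fun q : ↥P => c q = some (i, a)) := by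
    intro a
    ext q
    simp only [hS, Finset.mem_filter, Finset.mem_univ, true_and, ne_eq, and_iff_right_iff_imp]
    intro h
    rw [h]
    exact Option.some_ne_none _
  rw [hfil, hfil, hfil]
  rfl

omit [DecidableEq κ] [Fintype κ] [Fintype ι] [DecidableEq ι] in
/-- `gcd` of products of two sets of primes of `P` is the product over the intersection. [folklore] -/
private theorem gcd_prod_primes_eq (S T : Finset ↥P) :
    Nat.gcd (∏ q ∈ S, (q : ℕ)) (∏ q ∈ T, (q : ℕ)) = ∏ q ∈ S ∩ T, (q : ℕ) := by
  rw [← Finset.prod_inter_mul_prod_sdiff S T (fun q : ↥P => (q : ℕ)),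
    ← Finset.prod_inter_mul_prod_sdiff T S (fun q : ↥P => (q : ℕ)), Finset.inter_comm T S,
    Nat.gcd_mul_left]
  have hcop : Nat.Coprime (∏ q ∈ S \ T, (q : ℕ)) (∏ q ∈ T \ S, (q : ℕ)) := by
    refine Nat.Coprime.prod_left fun q hq => Nat.Coprime.prod_right fun q' hq' => ?_
    have hne : (q : ℕ) ≠ q' := by
      intro heq
      have : q = q' := Subtype.ext heq
      rw [this] at hq
      exact (Finset.mem_sdiff.1 hq).2 (Finset.mem_sdiff.1 hq').1
    exact (Nat.coprime_primes (prime_coe hP q) (prime_coe hP q')).2 hne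
  rw [hcop.gcd_eq_one, mul_one]

omit [DecidableEq ι] [Fintype ι] [Fintype κ] in
/-- `([e_j, e'_j], m) = 1` for a colouring iff no prime of colour index `j` divides `m`. [folklore] -/
private theorem coprime_lcm_colour_iff (c : ↥P → Colour κ) (j : κ) (m : ℕ) :
    Nat.Coprime (Nat.lcm (colourFst P c j) (colourSnd P c j)) m ↔
      ∀ q : ↥P, (∃ b, c q = some (j, b)) → ¬ (q : ℕ) ∣ m := by
  constructor
  · intro hcop q hq hqm
    have hql : (q : ℕ) ∣ Nat.lcm (colourFst P c j) (colourSnd P c j) := (dvd_lcm_colour_iff hP c j q).2 hq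
    have h1 : (q : ℕ) ∣ Nat.gcd (Nat.lcm (colourFst P c j) (colourSnd P c j)) m := Nat.dvd_gcd hql hqm
    rw [hcop.gcd_eq_one] at h1
    exact (prime_coe hP q).one_lt.ne' (Nat.dvd_one.1 h1)
  · intro h
    refine Nat.coprime_of_dvd fun p hp hpl hpm => ?_
    have hprodP : Nat.lcm (colourFst P c j) (colourSnd P c j) ∣ ∏ q ∈ P, q :=
      Nat.lcm_dvd (colourFst_dvd_prod hP c j) (colourSnd_dvd_prod hP c j)
    have hpP : p ∈ P := by
      obtain ⟨q, hq, hdvd⟩ := (hp.prime.dvd_finsetProd_iff _).1 (hpl.trans hprodP)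
      rwa [(Nat.prime_dvd_prime_iff_eq hp (hP q hq)).1 hdvd]
    exact h ⟨p, hpP⟩ ((dvd_lcm_colour_iff hP c j ⟨p, hpP⟩).1 hpl) hpm

/-- The cross condition prime by prime, on the pair of colours of a prime `q`: an `e`-colour
requires `q ∤ m`; a `d`-colour of index `i` together with an `e`-colour of index `j` requires
`(i, j) ∈ M q`. [cite: Maynard2016LargeGaps, §6 display (6.8)] -/
def AllowedAt (m : ℕ) (M : ℕ → Finset (ι × κ)) (q : ℕ) : Colour ι → Colour κ → Prop
  | _, none => True
  | none, some _ => ¬ q ∣ m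
  | some (i, _), some (j, _) => ¬ q ∣ m ∧ (i, j) ∈ M q

omit hP [DecidableEq ι] [Fintype ι] [DecidableEq κ] [Fintype κ] in
/-- `AllowedAt` with an `e`-colour forces `q ∤ m`. [folklore] -/
private theorem not_dvd_of_allowedAt {m : ℕ} {M : ℕ → Finset (ι × κ)} {q : ℕ} {o : Colour ι} {j : κ}
    {b : Fin 3} (h : AllowedAt m M q o (some (j, b))) : ¬ q ∣ m := by
  rcases o with _ | ⟨i, a⟩
  · exact h
  · exact h.1

omit [Fintype ι] [Fintype κ] in
/-- **The cross condition of a pair of colourings is the conjunction of the local conditions.**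
[cite: Maynard2016LargeGaps, §6 display (6.8)] -/
theorem crossCond_colour_iff (m : ℕ) (M : ℕ → Finset (ι × κ)) (cD : ↥P → Colour ι)
    (cE : ↥P → Colour κ) :
    CrossCond P m M (colourFst P cD, colourSnd P cD) (colourFst P cE, colourSnd P cE) ↔
      ∀ q : ↥P, AllowedAt m M q (cD q) (cE q) := by
  constructor
  · rintro ⟨h1, h2⟩ q
    rcases hD : cD q with _ | ⟨i, a⟩ <;> rcases hE : cE q with _ | ⟨j, b⟩
    · trivial
    · exact (coprime_lcm_colour_iff hP cE j m).1 (h1 j) q ⟨b, hE⟩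
    · trivial
    · exact ⟨(coprime_lcm_colour_iff hP cE j m).1 (h1 j) q ⟨b, hE⟩,
        h2 q q.2 i j ((dvd_lcm_colour_iff hP cD i q).2 ⟨a, hD⟩)
          ((dvd_lcm_colour_iff hP cE j q).2 ⟨b, hE⟩)⟩
  · intro h
    refine ⟨fun j => (coprime_lcm_colour_iff hP cE j m).2 fun q ⟨b, hE⟩ => ?_, fun q hq i j hdi hej => ?_⟩
    · have hq := h q
      rw [hE] at hq
      exact not_dvd_of_allowedAt hq
    · have hq' := h ⟨q, hq⟩
      obtain ⟨a, hD⟩ := (dvd_lcm_colour_iff hP cD i ⟨q, hq⟩).1 hdi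
      obtain ⟨b, hE⟩ := (dvd_lcm_colour_iff hP cE j ⟨q, hq⟩).1 hej
      rw [hD, hE] at hq'
      exact hq'.2

/-! ### The summand of a pair of colourings -/

/-- The `gcd`-factor of a pair of colours at `q`: `q` if the prime is coloured on both sides (it is
then counted once in the lcm), else `1`. [folklore] -/
def pairFactor (q : ℕ) : Colour ι → Colour κ → ℂ
  | some _, some _ => (q : ℂ)
  | _, _ => 1

omit hP [DecidableEq ι] [Fintype ι] [DecidableEq κ] [Fintype κ] in
/-- `pairFactor` as an indicator. [folklore] -/
private theorem pairFactor_eq (q : ℕ) (o : Colour ι) (o' : Colour κ) :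
    pairFactor q o o' = if o ≠ none ∧ o' ≠ none then (q : ℂ) else 1 := by
  rcases o with _ | ⟨i, a⟩ <;> rcases o' with _ | ⟨j, b⟩ <;> simp [pairFactor]

/-- The local weight of a pair of colours at the prime `q`:
`colourWeight(d-colour) · colourWeight(e-colour) · pairFactor`. [cite: Maynard2016LargeGaps, §6 display (6.11)] -/
def coupledWeight (g h : ι → ℕ → ℂ) (g' h' : κ → ℕ → ℂ) (q : ℕ) (o : Colour ι) (o' : Colour κ) : ℂ :=
  colourWeight g h q o * colourWeight g' h' q o' * pairFactor q o o'

/-- **The coupled summand of a pair of colourings is the product over the primes of the local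
weights** (multiplicativity of the numerators, `pairSummand_colour`, and
`gcd(∏_i D_i, ∏_j E_j) = ∏_{q coloured on both sides} q`). [cite: Maynard2016LargeGaps, §6 (proof of Lemma 6, "the summand is also multiplicative")] -/
theorem coupledSummand_colour (g h : ι → ℕ → ℂ) (g' h' : κ → ℕ → ℂ)
    (hg : ∀ i, IsPrimeProdMult (g i)) (hh : ∀ i, IsPrimeProdMult (h i))
    (hg' : ∀ j, IsPrimeProdMult (g' j)) (hh' : ∀ j, IsPrimeProdMult (h' j))
    (cD : ↥P → Colour ι) (cE : ↥P → Colour κ) :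
    coupledSummand g h g' h' (colourFst P cD, colourSnd P cD) (colourFst P cE, colourSnd P cE) =
      ∏ q : ↥P, coupledWeight g h g' h' q (cD q) (cE q) := by
  have hDpos : ∀ i, 0 < Nat.lcm (colourFst P cD i) (colourSnd P cD i) :=
    fun i => Nat.lcm_pos (colourFst_pos hP cD i) (colourSnd_pos hP cD i)
  have hEpos : ∀ j, 0 < Nat.lcm (colourFst P cE j) (colourSnd P cE j) :=
    fun j => Nat.lcm_pos (colourFst_pos hP cE j) (colourSnd_pos hP cE j)
  rw [coupledSummand_eq_mul_gcd g h g' h' hDpos hEpos, pairSummand_colour hP g h hg hh cD,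
    pairSummand_colour hP g' h' hg' hh' cE]
  simp only
  rw [prod_lcm_colour_eq hP cD, prod_lcm_colour_eq hP cE, gcd_prod_primes_eq hP,
    ← Finset.filter_and, Nat.cast_prod]
  have hsplit : ∀ q : ↥P, coupledWeight g h g' h' q (cD q) (cE q) =
      colourWeight g h q (cD q) * colourWeight g' h' q (cE q) *
        (if cD q ≠ none ∧ cE q ≠ none then ((q : ℕ) : ℂ) else 1) := fun q => by
    rw [coupledWeight, pairFactor_eq]
  rw [Finset.prod_congr rfl fun q _ => hsplit q, Finset.prod_mul_distrib, Finset.prod_ite,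
    Finset.prod_const_one, mul_one, Finset.prod_mul_distrib]

/-! ### The local factor: the sum of the local weights over the allowed pairs of colours -/

omit hP [DecidableEq ι] [Fintype ι] in
/-- `∑_{a} colourWeight(i,a) · X = (A_i(q)/q) · X`. [folklore] -/
private theorem sum_colourWeight_some_mul (g h : ι → ℕ → ℂ) {q : ℕ} (hq : (q : ℂ) ≠ 0) (i : ι)
    (X : ℂ) : ∑ a : Fin 3, colourWeight g h q (some (i, a)) * X = slotTerm g h q i / q * X := by
  rw [Fin.sum_univ_three]
  simp only [colourWeight, Fin.isValue, if_true, show (1 : Fin 3) = 0 ↔ False by decide,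
    show (2 : Fin 3) = 0 ↔ False by decide, show (2 : Fin 3) = 1 ↔ False by decide, if_false,
    slotTerm]
  field_simp

omit hP [DecidableEq ι] [DecidableEq κ] [Fintype ι] in
/-- Row `none` of the local sum: `1 + [q ∤ m] ∑_j B_j(q)/q`. [folklore] -/
private theorem sum_allowed_none (g h : ι → ℕ → ℂ) (g' h' : κ → ℕ → ℂ) (m : ℕ)
    (M : ℕ → Finset (ι × κ)) {q : ℕ} (hq : (q : ℂ) ≠ 0) :
    ∑ o' : Colour κ, (if AllowedAt m M q (none : Colour ι) o' then
        coupledWeight g h g' h' q none o' else 0) =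
      1 + (if q ∣ m then 0 else (∑ j, slotTerm g' h' q j) / q) := by
  rw [Fintype.sum_option]
  have h0 : (if AllowedAt m M q (none : Colour ι) (none : Colour κ) then
      coupledWeight g h g' h' q none none else 0) = 1 := by
    simp [AllowedAt, coupledWeight, colourWeight, pairFactor]
  rw [h0]
  congr 1
  have h1 : ∀ w : κ × Fin 3, (if AllowedAt m M q (none : Colour ι) (some w) then
      coupledWeight g h g' h' q none (some w) else 0) =
      if q ∣ m then 0 else colourWeight g' h' q (some w) * 1 := by
    rintro ⟨j, b⟩
    by_cases hm : q ∣ m <;> simp [AllowedAt, coupledWeight, colourWeight, pairFactor, hm]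
  simp_rw [h1]
  by_cases hm : q ∣ m
  · simp [hm]
  · simp only [hm, if_false]
    rw [Fintype.sum_prod_type, Finset.sum_div]
    refine Finset.sum_congr rfl fun j _ => ?_
    rw [sum_colourWeight_some_mul g' h' hq, mul_one]

omit hP [Fintype ι] in
/-- Row `some (i, a)` of the local sum:
`colourWeight(i,a) · (1 + [q ∤ m] ∑_{j : (i,j) ∈ M q} B_j(q))`. [folklore] -/
private theorem sum_allowed_some (g h : ι → ℕ → ℂ) (g' h' : κ → ℕ → ℂ) (m : ℕ)
    (M : ℕ → Finset (ι × κ)) {q : ℕ} (hq : (q : ℂ) ≠ 0) (i : ι) (a : Fin 3) :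
    ∑ o' : Colour κ, (if AllowedAt m M q (some (i, a)) o' then
        coupledWeight g h g' h' q (some (i, a)) o' else 0) =
      colourWeight g h q (some (i, a)) *
        (1 + if q ∣ m then 0 else ∑ j, if (i, j) ∈ M q then slotTerm g' h' q j else 0) := by
  rw [Fintype.sum_option]
  have h0 : (if AllowedAt m M q (some (i, a)) (none : Colour κ) then
      coupledWeight g h g' h' q (some (i, a)) none else 0) = colourWeight g h q (some (i, a)) := by
    simp [AllowedAt, coupledWeight, colourWeight, pairFactor]
  rw [h0, mul_add, mul_one]
  congr 1
  have h1 : ∀ w : κ × Fin 3, (if AllowedAt m M q (some (i, a)) (some w) then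
      coupledWeight g h g' h' q (some (i, a)) (some w) else 0) =
      if q ∣ m then 0 else
        if (i, w.1) ∈ M q then colourWeight g h q (some (i, a)) * (colourWeight g' h' q (some w) * q)
        else 0 := by
    rintro ⟨j, b⟩
    by_cases hm : q ∣ m
    · simp [AllowedAt, hm]
    · by_cases hM : (i, j) ∈ M q
      · simp [AllowedAt, coupledWeight, pairFactor, hm, hM, mul_assoc]
      · simp [AllowedAt, hm, hM]
  simp_rw [h1]
  by_cases hm : q ∣ m
  · simp [hm]
  · simp only [hm, if_false]
    rw [Fintype.sum_prod_type, Finset.mul_sum]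
    refine Finset.sum_congr rfl fun j _ => ?_
    by_cases hM : (i, j) ∈ M q
    · simp only [hM, if_true]
      rw [← Finset.mul_sum, sum_colourWeight_some_mul g' h' hq]
      field_simp
    · simp [hM]

omit hP in
/-- **The local sum in closed form**: `∑_{allowed (o,o')} coupledWeight q o o' = K_q`.
[cite: Maynard2016LargeGaps, §6 displays (6.11)–(6.13)] -/
theorem sum_allowed_coupledWeight_eq (g h : ι → ℕ → ℂ) (g' h' : κ → ℕ → ℂ) (m : ℕ)
    (M : ℕ → Finset (ι × κ)) {q : ℕ} (hq : q ≠ 0) :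
    ∑ w ∈ Finset.univ.filter (fun w : Colour ι × Colour κ => AllowedAt m M q w.1 w.2),
        coupledWeight g h g' h' q w.1 w.2 = coupledLocalFactor g h g' h' m M q := by
  have hqc : (q : ℂ) ≠ 0 := by exact_mod_cast hq
  rw [Finset.sum_filter, Fintype.sum_prod_type]
  simp only
  rw [Fintype.sum_option, sum_allowed_none g h g' h' m M hqc]
  simp_rw [Fintype.sum_prod_type, sum_allowed_some g h g' h' m M hqc]
  simp_rw [sum_colourWeight_some_mul g h hqc]
  -- the `M`-sum as an iterated sum
  have hM : ∑ p ∈ M q, slotTerm g h q p.1 * slotTerm g' h' q p.2 =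
      ∑ i, slotTerm g h q i * ∑ j, if (i, j) ∈ M q then slotTerm g' h' q j else 0 := by
    have : ∑ p ∈ M q, slotTerm g h q p.1 * slotTerm g' h' q p.2 =
        ∑ p : ι × κ, if p ∈ M q then slotTerm g h q p.1 * slotTerm g' h' q p.2 else 0 := by
      rw [← Finset.sum_filter, Finset.filter_mem_eq_inter, Finset.univ_inter]
    rw [this, Fintype.sum_prod_type]
    refine Finset.sum_congr rfl fun i _ => ?_
    rw [Finset.mul_sum]
    refine Finset.sum_congr rfl fun j _ => ?_
    split_ifs <;> simp
  rw [coupledLocalFactor, hM]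
  by_cases hm : q ∣ m
  · simp only [hm, if_true, add_zero, mul_one]
    rw [Finset.sum_div]
  · simp only [hm, if_false]
    rw [add_div, add_div, Finset.sum_div (s := Finset.univ) (f := fun i => slotTerm g h q i)]
    have hsplit : ∑ i, slotTerm g h q i / ↑q *
        (1 + ∑ j, if (i, j) ∈ M q then slotTerm g' h' q j else 0) =
        ∑ i, slotTerm g h q i / ↑q +
          (∑ i, slotTerm g h q i * (∑ j, if (i, j) ∈ M q then slotTerm g' h' q j else 0)) / ↑q := by
      rw [Finset.sum_div (s := Finset.univ)
        (f := fun i => slotTerm g h q i * (∑ j, if (i, j) ∈ M q then slotTerm g' h' q j else 0)),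
        ← Finset.sum_add_distrib]
      refine Finset.sum_congr rfl fun i _ => ?_
      ring
    rw [hsplit]
    ring

/-! ### The coupled Euler product -/

/-- **The coupled Euler product of Maynard's main term** ((6.10) = `∏_p K_p` with the `K_p` of
(6.11)–(6.13)): for a finite set of primes `P`, weights multiplicative over products of distinct
primes, any `m` and any coupling datum `M`,
`∑_{(d,d') adm.} ∑_{(e,e') adm.} [CrossCond] coupledSummand = ∏_{p ∈ P} coupledLocalFactor p`.
[cite: Maynard2016LargeGaps, §6 displays (6.10)–(6.13)] -/
theorem sum_coupled_eq_prod (g h : ι → ℕ → ℂ) (g' h' : κ → ℕ → ℂ)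
    (hg : ∀ i, IsPrimeProdMult (g i)) (hh : ∀ i, IsPrimeProdMult (h i))
    (hg' : ∀ j, IsPrimeProdMult (g' j)) (hh' : ∀ j, IsPrimeProdMult (h' j))
    (m : ℕ) (M : ℕ → Finset (ι × κ)) :
    ∑ tD ∈ (pairBox ι P).filter PairwiseCoprimeLcm, ∑ tE ∈ (pairBox κ P).filter PairwiseCoprimeLcm,
        (if CrossCond P m M tD tE then coupledSummand g h g' h' tD tE else 0) =
      ∏ q ∈ P, coupledLocalFactor g h g' h' m M q := by
  rw [sum_filter_pairBox_eq_sum_colour hP]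
  simp_rw [sum_filter_pairBox_eq_sum_colour hP]
  have h1 : ∀ (cD : ↥P → Colour ι) (cE : ↥P → Colour κ),
      (if CrossCond P m M (colourFst P cD, colourSnd P cD) (colourFst P cE, colourSnd P cE) then
        coupledSummand g h g' h' (colourFst P cD, colourSnd P cD) (colourFst P cE, colourSnd P cE)
        else 0) =
      if ∀ q : ↥P, AllowedAt m M q (cD q) (cE q) then
        ∏ q : ↥P, coupledWeight g h g' h' q (cD q) (cE q) else 0 := fun cD cE =>
    if_congr (crossCond_colour_iff hP m M cD cE)
      (coupledSummand_colour hP g h g' h' hg hh hg' hh' cD cE) rfl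
  simp_rw [h1]
  -- one colouring with values in `Colour ι × Colour κ`
  rw [← Fintype.sum_prod_type',
    ← (Equiv.arrowProdEquivProdArrow ↥P (fun _ => Colour ι) (fun _ => Colour κ)).sum_comp]
  simp only [Equiv.arrowProdEquivProdArrow_apply]
  rw [← Finset.sum_filter]
  have hset : Finset.univ.filter
      (fun c : ↥P → Colour ι × Colour κ => ∀ q : ↥P, AllowedAt m M (q : ℕ) (c q).1 (c q).2) =
      Fintype.piFinset (fun q : ↥P =>
        Finset.univ.filter (fun w : Colour ι × Colour κ => AllowedAt m M q w.1 w.2)) := by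
    ext c
    simp [Fintype.mem_piFinset]
  rw [hset, ← Finset.prod_univ_sum (fun q : ↥P =>
      Finset.univ.filter (fun w : Colour ι × Colour κ => AllowedAt m M q w.1 w.2))
    (fun q w => coupledWeight g h g' h' q w.1 w.2), ← Finset.prod_coe_sort P]
  exact Finset.prod_congr rfl fun q _ =>
    sum_allowed_coupledWeight_eq g h g' h' m M (prime_coe hP q).ne_zero

end Colour

end LcmEuler

end Literature.NumberTheory.Sieve
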